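import Summits.HodgeConjecture.HodgeConjecture.Theorems.SignSymmetricPowersFiveFactsProp423
import Summits.HodgeConjecture.HodgeConjecture.Theorems.SignSymmetricPowersSignDeckHodge
import Summits.HodgeConjecture.HodgeConjecture.Theorems.SignSymmetricPowersSignEigenHodgeOfGenusBound
import HarnessLib

/-!
# Crux K1-B `VeryGeneralSignCommutatorsInHg` and the rung leaf `SignThreefoldPowersHodge` modulo
# {PG, hPL, h423, hCDK, hA3}: the binder hV (Voisin's equivariant eigen-Hodge numbers) DISCHARGED modulo the geometric genus
# (route `SignSymmetricPowers`, items stmt-HodgeConjecture-19716 ∕ 19715; cell `hodge-nonav`)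

Prover seat `hodge-nonav-19716-p2` (g5). Landed `--supports stmt-HodgeConjecture-19716 --as helper`; sorry-free, no
definition, no new named fact. CONDITIONAL results; nothing here says HC ∕ HC_AV is proved; rung F-H1 is not moved.

THE RE-CUT. `SignSymmetricPowersFiveFactsProp423.veryGeneralSignCommutatorsInHg_of_five_facts_prop423` closes K1-B from
{hV, hPL, h423, hCDK, hB2} with hV = `voisin2003_finrank_eigenspace_inf_hodgePiece_of_diagonalStabilizer` (Voisin II Cor. 6.12
read equivariantly for a diagonal symmetry of a hypersurface of ANY dimension, in all Hodge degrees — in the tree a named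
fact, reduced only to Griffiths' residue package G5). hV enters K1-B ONLY through the registered stub `stub_signDeckHodge`
(the `ι`-eigen-Hodge numbers `shn d j q` of the sign involution on `H³` of a smooth `ι`-even quinary form), whose
CONCLUSION this file proves from the single textbook fact PG = `Arapura2012_hypersurface_geometricGenus`
(`h^{n,0}(X_F) = C(d−1, n+1)`; already the binder `stub_hypersurfaceGeometricGenus` of the sister crux K1-A,
stmt-HodgeConjecture-19544): `signDeckHodge_of_geometricGenus`, from the box-count theorem
`SignSymmetricPowersSignEigenHodgeOfGeometricGenus.finrank_signEigenspace_inf_piece_of_geometricGenus` (residues at pole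
order ONE for `H^{3,0}`, Hodge symmetry for `H^{0,3}`, and for `H^{2,1}`, `H^{1,2}` the `±`-Betti numbers `b₃^±` read at
the Fermat threefold by EQUIVARIANT Ehresmann + the odd-dimensional Fermat character count — all tree theorems of this
seat's Literature files `FermatEigenspaceNonvanishingOdd`, `FermatOddMiddleBettiNumber`, `DiagonalElementEigenspaces`,
`MonomialSupportedHypersurfaceEquivariantBetti`, `BettiUniverseEigenspacePieces`) and the line's own combinatorics
(`card_box_parity_eq`, `fold5_getD_eq_card` of `SignSymmetricPowersSignDeckHodge`). Hence, through the tree's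
`SignSymmetricPowersSevenFactsKernel.veryGeneralSignCommutatorsInHg_of_signDeckHodge` with ZvK, D1 theorems and hGIC ⟸ h423:

* `veryGeneralSignCommutatorsInHg_of_geometricGenus_four_facts` — **K1-B ⟸ {PG, hPL, h423, hCDK, hB2}**;
* `signThreefoldPowersHodge_of_geometricGenus_four_facts` — the rung leaf likewise.

Registry consequence (P3): `stub_voisinEigenHodgeNumbers : voisin2003_…` of stmt-HodgeConjecture-19716 may be re-pointed
to `Literature.AlgebraicGeometry.HodgeTheory.Arapura2012_hypersurface_geometricGenus` (shared with 19544's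
`stub_hypersurfaceGeometricGenus`) with THIS file's compositions as the sorry-free consumer BY NAME; the union of the
cited inputs of the cell's two K1 cruxes loses hV ∕ G5.

## References

* [VoisinHodgeII2003] C. Voisin, Hodge Theory and Complex Algebraic Geometry II (2003), §6.1.3 Thm. 6.10 ∕ Cor. 6.12,
  §4.3.3 Prop. 4.23.
* [Arapura2012] D. Arapura, Algebraic Geometry over the Complex Numbers (2012), §17.3 (17.3.1), Cor. 17.3.5.
* [Shioda1979HodgeFermat] T. Shioda, The Hodge conjecture for Fermat varieties, Math. Ann. 245 (1979), §1.
* [CarlsonMullerStachPeters2017] J. Carlson, S. Müller-Stach, C. Peters, Period Mappings and Period Domains (2017),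
  §7.4 Thm. 7.4.1.
* [CattaniDeligneKaplan1995] E. Cattani, P. Deligne, A. Kaplan, On the locus of Hodge classes, JAMS 8 (1995), Thm. 1.1.
-/

noncomputable section

open Finset MvPolynomial
open Literature.RingTheory.MvPolynomial Literature.AlgebraicGeometry.Motives Literature.AlgebraicGeometry.HodgeTheory
open Literature.AlgebraicGeometry.FundamentalGroup (affineHypersurfaceComplement_meridians_normalClosure_eq_top_holds)

-- mandated namespace `Summit.HodgeConjecture.HodgeConjecture.Theorems` trips `linter.dupNamespace` (off tree-wide)
set_option linter.dupNamespace false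

namespace Summit.HodgeConjecture.HodgeConjecture.Theorems.SignSymmetricPowersFourFactsGeometricGenus

open SignSymmetricPowersSignDeckHodge SignSymmetricPowersSignEigenHodgeOfGenusBound

/-- **The registered signature of `stub_signDeckHodge`, WITHOUT its hypothesis hV, from the bound `h^{3,0}(X_f) ≤ C(d−1,4)`**
(inlined binder `hpg3`, the `≤` half of PG for smooth quinary forms): for every smooth `ι`-even quinary form `f` of even
degree `d ≥ 4`, the `(−1)^j`-eigenspace of `ι = diag(−1,−1,1,1,1)` on `H^{3−q,q}(X_f)` has dimension `shn d j q`. Proof: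
the box count of `finrank_signEigenspace_inf_piece_of_genusBound` turned into the line's generating function exactly as
in `stub_signDeckHodge` (steps (3): `prod_signInvolutionVector_pow_eq_iff`, `card_box_parity_eq`, `fold5_getD_eq_card`).
CONDITIONAL on `hpg3`. [cite: VoisinHodgeII2003, §6.1.3 Cor. 6.12] [cite: Arapura2012, §17.3 (17.3.1)]
[cite: CarlsonMullerStachPeters2017, §7.4 Thm. 7.4.1] -/
theorem signDeckHodge_of_genusBound
    (hpg3 : ∀ ⦃d : ℕ⦄ (f : MvPolynomial (Fin 5) ℂ), f.IsHomogeneous d → SmoothHypersurface.IsNonsingularForm ℂ f →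
      ∀ (hXF : IsSmoothProjective 3 (SmoothHypersurface.hypersurface f)),
        Module.finrank ℂ ↥((BettiUniverse.hodge exists_isReal_hodgeModel_holds hXF 3).piece 3 0) ≤ (d - 1).choose 4) :
    open Literature.AlgebraicGeometry.Motives Literature.AlgebraicGeometry.HodgeTheory Literature.AlgebraicGeometry.HodgeTheory.BettiUniverse CategoryTheory.Limits in let pmul2 : List (ℕ × ℕ) → List (ℕ × ℕ) → List (ℕ × ℕ) := fun a b => (List.range (a.length + b.length - 1)).map fun k => (((List.range (k + 1)).map fun i => (a.getD i (0, 0)).1 * (b.getD (k - i) (0, 0)).1 + (a.getD i (0, 0)).2 * (b.getD (k - i) (0, 0)).2).sum, ((List.range (k + 1)).map fun i => (a.getD i (0, 0)).1 * (b.getD (k - i) (0, 0)).2 + (a.getD i (0, 0)).2 * (b.getD (k - i) (0, 0)).1).sum); let fac : ℕ → Bool → List (ℕ × ℕ) := fun d odd => (List.range (d - 1)).map fun k => if odd ∧ ¬ Even k then (0, 1) else (1, 0); let shn : ℕ → ℕ → ℕ → ℕ := fun d j q => if (q + 1) * d < 5 then 0 else if j = 0 then (([fac d true, fac d false, fac d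 false, fac d false].foldl pmul2 (fac d true)).getD ((q + 1) * d - 5) (0, 0)).1 else (([fac d true, fac d false, fac d false, fac d false].foldl pmul2 (fac d true)).getD ((q + 1) * d - 5) (0, 0)).2; ∀ ⦃d : ℕ⦄, Even d → 4 ≤ d → ∀ f : MvPolynomial (Fin 5) ℂ, f.IsHomogeneous d → (∀ e : Fin 5 →₀ ℕ, ¬ Even (e 0 + e 1) → f.coeff e = 0) → SmoothHypersurface.IsNonsingularForm ℂ f → ∀ (hXF : IsSmoothProjective 3 (SmoothHypersurface.hypersurface f)) (ha : (fun i : Fin 5 => if (i : ℕ) < 2 then (-1 : ℂˣ) else 1) ∈ diagonalStabilizer f), ∀ j q : ℕ, j < 2 → q ≤ 3 → Module.finrank ℂ ↥(Module.End.eigenspace ((pull (diagonalAut f ha) 3).baseChange ℂ) ((-1 : ℂ) ^ j) ⊓ (hodge exists_isReal_hodgeModel_holds hXF 3).piece ((3 : ℤ) - q) q) = shn d j q := by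
  intro pmul2 fac shn d hd h4 f hf _hcoef hns hXF ha j q hj hq
  have hpm : ∀ a b, pmul2 a b = (List.range (a.length + b.length - 1)).map fun k =>
      (((List.range (k + 1)).map fun i =>
          (a.getD i (0, 0)).1 * (b.getD (k - i) (0, 0)).1 + (a.getD i (0, 0)).2 * (b.getD (k - i) (0, 0)).2).sum,
       ((List.range (k + 1)).map fun i =>
          (a.getD i (0, 0)).1 * (b.getD (k - i) (0, 0)).2 + (a.getD i (0, 0)).2 * (b.getD (k - i) (0, 0)).1).sum) :=
    fun a b ↦ rfl
  have hfc : ∀ d p, fac d p = (List.range (d - 1)).map fun k => if p ∧ ¬ Even k then (0, 1) else (1, 0) :=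
    fun d p ↦ rfl
  -- the box count from the geometric genus
  refine (finrank_signEigenspace_inf_piece_of_genusBound hpg3 hd h4 f hf hns hXF ha hj hq).trans ?_
  change _ = if (q + 1) * d < 5 then 0 else if j = 0 then
      ((pmul2 (pmul2 (pmul2 (pmul2 (fac d true) (fac d true)) (fac d false)) (fac d false)) (fac d false)).getD
        ((q + 1) * d - 5) (0, 0)).1 else
      ((pmul2 (pmul2 (pmul2 (pmul2 (fac d true) (fac d true)) (fac d false)) (fac d false)) (fac d false)).getD
        ((q + 1) * d - 5) (0, 0)).2
  by_cases hlt : (q + 1) * d < 5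
  · rw [if_pos hlt, if_pos hlt]
  rw [if_neg hlt, if_neg hlt]
  -- combinatorics of the line: box count → nested-pair count → generating function
  have hfilt : (((univ : Finset (Fin 5)).finsuppAntidiag ((q + 1) * d - 5)).filter
      fun β : Fin 5 →₀ ℕ ↦ (∀ i, β i ≤ d - 2) ∧
        (∏ i, ((signInvolutionVector i : ℂˣ) : ℂ) ^ β i) = (-1) ^ j) =
      ((univ : Finset (Fin 5)).finsuppAntidiag ((q + 1) * d - 5)).filter
        fun β : Fin 5 →₀ ℕ ↦ (∀ i, β i ≤ d - 2) ∧ (j = 0 ↔ Even (β 0 + β 1)) :=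
    filter_congr fun β _ ↦ by rw [prod_signInvolutionVector_pow_eq_iff β hj]
  rw [hfilt, card_box_parity_eq d _ (by omega) (fun m ↦ (j = 0 ↔ Even m)),
    fold5_getD_eq_card pmul2 hpm fac hfc d ((q + 1) * d - 5)]
  obtain rfl | rfl : j = 0 ∨ j = 1 := by omega
  · simp only [if_true, true_iff]
  · simp only [one_ne_zero, if_false, false_iff]

/-- **PG ⟹ the bound**: `Arapura2012_hypersurface_geometricGenus` (`h^{n,0}(X_F) = C(d−1,n+1)`) gives
`h^{3,0}(X_f) ≤ C(d−1,4)` for every nonsingular quinary form (degree `0` is excluded by smoothness: `V₊(unit)` is empty,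
`not_isUnit_of_isSmoothProjective_hypersurface`). [cite: Arapura2012, §17.3 (17.3.1)] -/
theorem genusBound_of_geometricGenus (hPG : Arapura2012_hypersurface_geometricGenus) ⦃d : ℕ⦄
    (f : MvPolynomial (Fin 5) ℂ) (hf : f.IsHomogeneous d) (hns : SmoothHypersurface.IsNonsingularForm ℂ f)
    (hXF : IsSmoothProjective 3 (SmoothHypersurface.hypersurface f)) :
    Module.finrank ℂ ↥((BettiUniverse.hodge exists_isReal_hodgeModel_holds hXF 3).piece 3 0) ≤ (d - 1).choose 4 := by
  -- `d ≥ 1`: an empty hypersurface is not a variety (`d = 0` would make the nonsingular `f` a non-zero constant)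
  have hd : 1 ≤ d := by
    by_contra hd0
    have hd0' : d = 0 := by omega
    subst hd0'
    have hF0 : f ≠ 0 := hns.ne_zero
    apply not_isUnit_of_isSmoothProjective_hypersurface hXF
    have htd : f.totalDegree = 0 := hf.totalDegree hF0
    rw [MvPolynomial.totalDegree_eq_zero_iff_eq_C] at htd
    have hc : MvPolynomial.coeff 0 f ≠ 0 := fun h ↦ hF0 (by rw [htd, h, map_zero])
    rw [htd]
    exact (isUnit_iff_ne_zero.mpr hc).map MvPolynomial.C
  exact le_of_eq (hPG exists_isReal_hodgeModel_holds (n := 3) (by norm_num) hd f hf hns hXF)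

/-- **The registered signature of `stub_signDeckHodge`, WITHOUT its hypothesis hV, from the geometric genus PG.**
CONDITIONAL on PG. [cite: Arapura2012, §17.3 (17.3.1)] [cite: VoisinHodgeII2003, §6.1.3 Cor. 6.12] -/
theorem signDeckHodge_of_geometricGenus (hPG : Arapura2012_hypersurface_geometricGenus) :
    open Literature.AlgebraicGeometry.Motives Literature.AlgebraicGeometry.HodgeTheory Literature.AlgebraicGeometry.HodgeTheory.BettiUniverse CategoryTheory.Limits in let pmul2 : List (ℕ × ℕ) → List (ℕ × ℕ) → List (ℕ × ℕ) := fun a b => (List.range (a.length + b.length - 1)).map fun k => (((List.range (k + 1)).map fun i => (a.getD i (0, 0)).1 * (b.getD (k - i) (0, 0)).1 + (a.getD i (0, 0)).2 * (b.getD (k - i) (0, 0)).2).sum, ((List.range (k + 1)).map fun i => (a.getD i (0, 0)).1 * (b.getD (k - i) (0, 0)).2 + (a.getD i (0, 0)).2 * (b.getD (k - i) (0, 0)).1).sum); let fac : ℕ → Bool → List (ℕ × ℕ) := fun d odd => (List.range (d - 1)).map fun k => if odd ∧ ¬ Even k then (0, 1) else (1, 0); let shn : ℕ → ℕ → ℕ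 → ℕ := fun d j q => if (q + 1) * d < 5 then 0 else if j = 0 then (([fac d true, fac d false, fac d false, fac d false].foldl pmul2 (fac d true)).getD ((q + 1) * d - 5) (0, 0)).1 else (([fac d true, fac d false, fac d false, fac d false].foldl pmul2 (fac d true)).getD ((q + 1) * d - 5) (0, 0)).2; ∀ ⦃d : ℕ⦄, Even d → 4 ≤ d → ∀ f : MvPolynomial (Fin 5) ℂ, f.IsHomogeneous d → (∀ e : Fin 5 →₀ ℕ, ¬ Even (e 0 + e 1) → f.coeff e = 0) → SmoothHypersurface.IsNonsingularForm ℂ f → ∀ (hXF : IsSmoothProjective 3 (SmoothHypersurface.hypersurface f)) (ha : (fun i : Fin 5 => if (i : ℕ) < 2 then (-1 : ℂˣ) else 1) ∈ diagonalStabilizer f), ∀ j q : ℕ, j < 2 → q ≤ 3 → Module.finrank ℂ ↥(Module.End.eigenspace ((pull (diagonalAut f ha) 3).baseChange ℂ) ((-1 : ℂ) ^ j) ⊓ (hodge exists_isReal_hodgeModel_holds hXF 3).piece ((3 : ℤ) - q) q) = shn d j q :=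
  signDeckHodge_of_genusBound (genusBound_of_geometricGenus hPG)

/-- **Crux K1-B `VeryGeneralSignCommutatorsInHg` modulo {`h^{3,0} ≤ C(d−1,4)` (inlined), hPL, h423, hCDK, hB2}** — the
binder hV DISCHARGED modulo the genus bound: the tree's `veryGeneralSignCommutatorsInHg_of_signDeckHodge` fed
`signDeckHodge_of_genusBound hpg3`, with ZvK and the nodal local branches of the discriminant supplied by their tree
theorems and the partie fixe by Voisin II Prop. 4.23 (`deligne_globalInvariantCycles_of_rangeRestrict h423`).
CONDITIONAL; nothing here says HC ∕ HC_AV is proved. [cite: Arapura2012, §17.3 (17.3.1)]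
[cite: VoisinHodgeII2003, §4.3.3 Prop. 4.23] [cite: CattaniDeligneKaplan1995, Thm. 1.1 and Cor. 1.2] -/
theorem veryGeneralSignCommutatorsInHg_of_genusBound_four_facts
    (hpg3 : ∀ ⦃d : ℕ⦄ (f : MvPolynomial (Fin 5) ℂ), f.IsHomogeneous d → SmoothHypersurface.IsNonsingularForm ℂ f →
      ∀ (hXF : IsSmoothProjective 3 (SmoothHypersurface.hypersurface f)),
        Module.finrank ℂ ↥((BettiUniverse.hodge exists_isReal_hodgeModel_holds hXF 3).piece 3 0) ≤ (d - 1).choose 4)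
    (hPL : Literature.AlgebraicGeometry.HodgeTheory.picardLefschetz_nodalForms_uniform)
    (h423 : Literature.AlgebraicGeometry.HodgeTheory.voisin2003_rangeRestrict_eq_of_compactification)
    (hCDK : Literature.AlgebraicGeometry.HodgeTheory.cmsp_nonHodgeGenericPoints_countable_algebraic_cover)
    (hB2 : Literature.AlgebraicGeometry.HodgeTheory.picardLefschetz_symmetricA3) :
    Summit.HodgeConjecture.HodgeConjecture.Theses.SignSymmetricPowers.VeryGeneralSignCommutatorsInHg :=
  SignSymmetricPowersSevenFactsKernel.veryGeneralSignCommutatorsInHg_of_signDeckHodge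
    (signDeckHodge_of_genusBound hpg3) affineHypersurfaceComplement_meridians_normalClosure_eq_top_holds @hPL
    (deligne_globalInvariantCycles_of_rangeRestrict h423) discriminant_localBranches_nodal_holds @hCDK @hB2

/-- **Crux K1-B `VeryGeneralSignCommutatorsInHg` modulo {PG, hPL, h423, hCDK, hB2}** — hV DISCHARGED modulo the geometric
genus: the tree's `veryGeneralSignCommutatorsInHg_of_signDeckHodge` fed `signDeckHodge_of_geometricGenus hPG`, with ZvK
and the nodal local branches of the discriminant supplied by their tree theorems and the partie fixe by Voisin II Prop. 4.23
(`deligne_globalInvariantCycles_of_rangeRestrict h423`). CONDITIONAL; nothing here says HC ∕ HC_AV is proved.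
[cite: Arapura2012, §17.3 (17.3.1)] [cite: VoisinHodgeII2003, §4.3.3 Prop. 4.23] [cite: CattaniDeligneKaplan1995, Thm. 1.1 and Cor. 1.2] -/
theorem veryGeneralSignCommutatorsInHg_of_geometricGenus_four_facts
    (hPG : Literature.AlgebraicGeometry.HodgeTheory.Arapura2012_hypersurface_geometricGenus)
    (hPL : Literature.AlgebraicGeometry.HodgeTheory.picardLefschetz_nodalForms_uniform)
    (h423 : Literature.AlgebraicGeometry.HodgeTheory.voisin2003_rangeRestrict_eq_of_compactification)
    (hCDK : Literature.AlgebraicGeometry.HodgeTheory.cmsp_nonHodgeGenericPoints_countable_algebraic_cover)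
    (hB2 : Literature.AlgebraicGeometry.HodgeTheory.picardLefschetz_symmetricA3) :
    Summit.HodgeConjecture.HodgeConjecture.Theses.SignSymmetricPowers.VeryGeneralSignCommutatorsInHg :=
  veryGeneralSignCommutatorsInHg_of_genusBound_four_facts (genusBound_of_geometricGenus hPG) @hPL @h423 @hCDK @hB2

/-- **The rung leaf `SignThreefoldPowersHodge` modulo {PG, hPL, h423, hCDK, hB2}** (composition with the landed
`signThreefoldPowersHodge_of_veryGeneralSignCommutatorsInHg`). CONDITIONAL; rung F-H1 not moved.
[cite: Arapura2012, §17.3 (17.3.1)] [cite: VoisinHodgeII2003, §4.3.3 Prop. 4.23] [cite: CattaniDeligneKaplan1995, Thm. 1.1 and Cor. 1.2] -/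
theorem signThreefoldPowersHodge_of_geometricGenus_four_facts
    (hPG : Literature.AlgebraicGeometry.HodgeTheory.Arapura2012_hypersurface_geometricGenus)
    (hPL : Literature.AlgebraicGeometry.HodgeTheory.picardLefschetz_nodalForms_uniform)
    (h423 : Literature.AlgebraicGeometry.HodgeTheory.voisin2003_rangeRestrict_eq_of_compactification)
    (hCDK : Literature.AlgebraicGeometry.HodgeTheory.cmsp_nonHodgeGenericPoints_countable_algebraic_cover)
    (hB2 : Literature.AlgebraicGeometry.HodgeTheory.picardLefschetz_symmetricA3) :
    Summit.HodgeConjecture.HodgeConjecture.Theses.SignSymmetricPowers.SignThreefoldPowersHodge :=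
  SignSymmetricPowersSignThreefoldPowersHodge.signThreefoldPowersHodge_of_veryGeneralSignCommutatorsInHg
    (veryGeneralSignCommutatorsInHg_of_geometricGenus_four_facts @hPG @hPL @h423 @hCDK @hB2)

end Summit.HodgeConjecture.HodgeConjecture.Theorems.SignSymmetricPowersFourFactsGeometricGenus

end
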